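import Literature.MathematicalPhysics.QuantumFieldTheory.Balaban1983to89.B9Eq358TaxiLettersY
import Literature.MathematicalPhysics.QuantumFieldTheory.Balaban1983to89.B9SectBGClassLettersY
import Literature.MathematicalPhysics.QuantumFieldTheory.Balaban1983to89.B9Eq3132Ineq2142Covariant

/-!
# `Balaban1983to89.B9Eq359VarParBY` — B9 (3.80)–(3.81) p. 406 with p. 401: THE BOND-AVERAGING TRANSPORTER VARIATION LAW `VarParBY` OF THE ROW-13
# G FRAME AT NODE 00's TAXICAB TRANSPORTERS `parBY`, DERIVED from the record's class (3.37) (the displayed law `hvarB` of gen 13's `gFrame₅CodedOn`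
# discharged at the record)

T. Bałaban, *Propagators for lattice gauge theories in a background field*, Commun. Math. Phys. **99** (1985) 389–434
[`Balaban1985BackgroundPropagators`, "B9"]; [4] = T. Bałaban, *Propagators and renormalization transformations for lattice gauge theories. II*,
Commun. Math. Phys. **96** (1984) 223–250 [`Balaban1984PropagatorsII`]; [3] = part I, Commun. Math. Phys. **95** (1984) 17–40 [`Balaban1984PropagatorsI`].

statement-level skeleton of published theorems with citation tags; proofs where landed; nothing here is a claim about the Yang–Mills mass gap

THE PRINTED LOCUS.  p. 401: *«… by the above bounds |(U′U)(Γ^{(j)}_{y,x})(U(Γ^{(j)}_{y,x}))⁻¹ − 1| < O(1)α₁»*; (3.80)–(3.81) p. 406: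
*«Q(U′U) = Q(U) + F₂(A), … |F₂(A)| ≦ O(1)α₁»*; (3.12) p. 392 (the bond averaging `Q` with the transporters `U(Γ_{y,x})` along the contours from the block's
base point to the averaged bonds); (3.37) p. 396; [3] (1.18) p. 20 («x(b) is a point in B^k(b₊)»); [4] (2.2)–(2.4) p. 224.

WHY THIS FILE (seat dag-n06-c gen 15, unit (C) part 2).  gen 13's G frame instance `gFrame₅CodedOn` displays the law
`hvarB : C37 β U a → VarParBY x parB cVar β U a` (`B9SectBGClassLettersY.VarParBY`: along every bond-averaging contour `Γ` of an index bond `ι` and an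
averaged fine bond `f` (`qK ι f ≠ 0`), the adjoint actions of the transporters of `e^{iηa}·U` and of `U` (and of their inverses) differ by `≦ c_var·β` in operator
norm).  THIS FILE proves it at NODE 00's transporter table `parBY` (taxicab contours, `Node00.OpsYTransport.parBY`) from r06's class `Cplx337` on the member's
torus chart and `U` `G`-valued: §1 cube coordinates — the corner of the coarse cube `B^j(y)`, membership by coordinates, and ★ `iterBlockOf_of_double`: a site
whose coordinates sit in `[corner, corner + Lʲ)` except in one direction where `[corner, corner + 2Lʲ)` lies in the DOUBLE CUBE `B^j(y) ∪ B^j(y + e_μ)`;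
§2 ★ `rung_mem_double_of_qK_ne_zero`: every rung site of the taxicab contour from the base point `embIter j ι₋` to the source of an averaged bond lies in the
double cube of `ι` (n06-i's `rungSites_taxiSteps` ∕ `onArc_mem_interval`), hence has level `≥ j − 1` ([4] (2.2), `lev_ends_bounds`) and the own-level (3.37)
gives `η|a| ≦ α₁L^{−(j−1)}` there; §3 ★★ `norm_parTaxiV_qRun_sub_le`: g8's product defect along the run (`≦ (d+1)(2Lʲ − 1)` steps, `ε = 2α₁L^{−(j−1)}`,
`(1+ε)ⁿ − 1 ≦ 4(d+1)Lα₁·e^{(d+1)L}`); §4 `cVarGY d ℓ = 8(d+1)L·e^{3(d+1)L}` (def), `varParBY_mono`, ★★★ `varParBY_parBY_of_cplx337` — `VarParBY x.toKIdx (parBY x.toKIdx)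
(cVarGY d ℓ) α₁ U a`.  (The consumer `B9SectBCodedClassGY` puts it into the extended coded class `C37GY`.)

HONEST SCOPE.  An elementary estimate over def-Y's DEFINED letters (taxicab transport, centre-based cubes); the (3.37) input is r06's class on the chart;
nothing of Theorem 3.1 asserted; COUNT-NEUTRAL; N06 NOT discharged; one finite lattice programme — nothing continuum ∕ OS ∕ mass-gap ∕ Clay.  No `sorry`, no
`axiom`, no `instance`, no `notation`; two bookkeeping `def`s (`cubeCorner`, the constant `cVarGY`).  Cell `pub-ymgap` (HUMAN RULING D-0062), Track A node N06 [B9], N06-ASSIGNMENT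
row 13, 2026-08-29; `--supports stmt-QuantumFields-27364`.

RELATED IN THE TREE, NOT DUPLICATED (used by name): `B9Eq358TaxiLettersY` (g8: `norm_stepRun_prod_sub_le` ∕ `norm_inv_stepRun_prod_sub_le` ∕
`norm_stepRun_prod_le` ∕ `norm_inv_stepRun_prod_le`, `norm_fluct_sub_one_le`, `norm_Rclm_sub_le`, `min_val_sub_le`; its `norm_parTaxiV_prod_sub_le` is the
ONE-block twin of §3), `B9Eq340TaxiRungs` (`rungSites_taxiSteps`, `onArc_mem_interval`, `length_taxiSteps_le`), `B9Eq340StepLasso` (`parTaxiV_eq_stepRun`,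
`unitaryLike_stepRun`), `B6Ineq2142KLevelV1` (`exists_of_qwt_ne_zero`, `lev_ends_bounds`, `one_le_lvl`), `B9Eq3132Ineq2142Covariant` (`qK_apply`, `two_le_RMh`),
`B5Eq118OneStroke` (`mem_iterBlock_iff`), `B6AgreeQaQV1Chart.sitesPerDir_zero_eq_mul`, `B9SectBGClassLettersY.VarParBY`, `Node00.OpsYTransport.parBY`.
-/

noncomputable section

namespace Literature.MathematicalPhysics.QuantumFieldTheory.Balaban1983to89.B9Eq359VarParBY

open Complex
open LatticeFieldCalculus
open T4RelativeLadder (UnitaryLike)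
open B5Eq118OneStroke (iterBlockOf iterBlock mem_iterBlock mem_iterBlock_iff iterBlockOf_succ)
open B15DeterminingSets (embIter)
open B6AgreeQaQV1Chart (sitesPerDir_zero_eq_mul)
open B6GlobalChartV1 (PV toBox boxEquiv)
open B6KLevelCensusIndexV1 (KIdx kGeo)
open B6Ineq2142KLevelV1 (lvl lev_ends_bounds exists_of_qwt_ne_zero one_le_lvl)
open B9BackgroundsKLevelV1 (CfgV1 shiftsV1 levV1)
open B9Eq39Adjoint (R fluct)
open B9Eq335RegularityClasses (Cplx337 OnOmega)
open LatticeNorms (scaleLen)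
open B9Eq340StepLasso (stepRun rungSites taxiSteps parTaxiV_eq_stepRun unitaryLike_stepRun)
open B9Eq340TaxiRungs (OnArc rungSites_taxiSteps onArc_mem_interval length_taxiSteps_le)
open B9Eq358TaxiLettersY (norm_stepRun_prod_le norm_inv_stepRun_prod_le norm_stepRun_prod_sub_le norm_inv_stepRun_prod_sub_le norm_fluct_sub_one_le
  norm_Rclm_sub_le min_val_sub_le)
open B9Eq360DeltaPrimeAY (AfldY mulY Rclm Rclm_apply)
open B9Eq3132Ineq2142Covariant (qK_apply two_le_RMh)
open B9PinMembersKLevelV1 (MemberY geo9Y)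
open B9SectBGpLettersY (GVal decY decY_prod norm_le_one_and_inv_of_mem)
open B9SectBGClassLettersY (VarParBY)
open B9GeoLemma21KLevelV1 (geo9K_eta_pos geo9K_one_le_L)
open Node00 (SiteY BlkY IBondY FBondY CfgY parBY parTaxiV qK qT)

variable {𝔸 : Type} [NormedRing 𝔸] [NormedAlgebra ℂ 𝔸] [CompleteSpace 𝔸]

/-! ## §1 Cube coordinates: the corner of `B^j(y)`, membership by coordinates, the double cube -/

section Cube

variable {P : Params}

/-- the CORNER of the coarse cube `B^j(y) ⊂ T^{(0)}`: fine labels `y_ν·Lʲ`. [cite: Balaban1984PropagatorsI, (1.6) p.18, (1.18) p.20, bookkeeping] -/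
def cubeCorner (j : ℕ) (y : Site P j) : Site P 0 := fun ν => ((((y ν).val * P.L ^ j : ℕ)) : ZMod (P.sitesPerDir 0))

/-- the corner's labels ARE `y_ν·Lʲ` (no reduction: `y_ν·Lʲ < Lʲ·|T^{(j)}| = |T^{(0)}|`). [cite: Balaban1984PropagatorsI, (1.6) p.18, bookkeeping] -/
theorem val_cubeCorner {j : ℕ} (hj : j ≤ P.m + P.K) (y : Site P j) (ν : Fin P.d) : (cubeCorner j y ν).val = (y ν).val * P.L ^ j := by
  have hn : P.sitesPerDir 0 = P.L ^ j * P.sitesPerDir j := sitesPerDir_zero_eq_mul P hj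
  have hlt : (y ν).val * P.L ^ j < P.sitesPerDir 0 := by
    rw [hn, mul_comm]
    exact Nat.mul_lt_mul_of_pos_left (ZMod.val_lt _) (pow_pos P.L_pos _)
  unfold cubeCorner
  rw [ZMod.val_natCast, Nat.mod_eq_of_lt hlt]

/-- ★ **A FINE SITE LIES IN `B^j(y)` ALONG `ν` IFF ITS LABEL IS WITHIN `Lʲ` FORWARD STEPS OF THE CORNER's** (`⌊label∕Lʲ⌋ = y_ν`).
[cite: Balaban1984PropagatorsI, (1.6) p.18, (1.18) p.20, bookkeeping] -/
theorem val_sub_corner_lt_iff {j : ℕ} (hj : j ≤ P.m + P.K) (y : Site P j) (w : Site P 0) (ν : Fin P.d) :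
    (w ν - cubeCorner j y ν).val < P.L ^ j ↔ (w ν).val / P.L ^ j = (y ν).val := by
  set q : ℕ := P.L ^ j with hq
  have hq0 : 0 < q := pow_pos P.L_pos _
  have hn : P.sitesPerDir 0 = q * P.sitesPerDir j := sitesPerDir_zero_eq_mul P hj
  have hc : (cubeCorner j y ν).val = (y ν).val * q := val_cubeCorner hj y ν
  have hy : (y ν).val < P.sitesPerDir j := ZMod.val_lt _
  have hwn : (w ν).val < P.sitesPerDir 0 := ZMod.val_lt _
  constructor
  · intro h
    -- `w_ν = corner + r`, `r < Lʲ`, no reduction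
    have e : w ν = cubeCorner j y ν + (w ν - cubeCorner j y ν) := by abel
    have hsum : (y ν).val * q + (w ν - cubeCorner j y ν).val < P.sitesPerDir 0 := by
      calc (y ν).val * q + (w ν - cubeCorner j y ν).val < (y ν).val * q + q := by omega
        _ = ((y ν).val + 1) * q := by ring
        _ ≤ P.sitesPerDir j * q := Nat.mul_le_mul_right _ hy
        _ = q * P.sitesPerDir j := mul_comm _ _
        _ = P.sitesPerDir 0 := hn.symm
    have hval : (w ν).val = (y ν).val * q + (w ν - cubeCorner j y ν).val := by
      conv_lhs => rw [e]
      rw [ZMod.val_add, hc, Nat.mod_eq_of_lt hsum]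
    rw [hval, mul_comm, Nat.mul_add_div hq0, Nat.div_eq_of_lt h, add_zero]
  · intro h
    have hdm := Nat.div_add_mod (w ν).val q
    rw [h] at hdm
    -- `corner ≤ w_ν`, difference `= label mod Lʲ < Lʲ`
    have hle : (cubeCorner j y ν).val ≤ (w ν).val := by rw [hc]; rw [mul_comm]; omega
    rw [ZMod.val_sub hle, hc]
    have : (w ν).val - (y ν).val * q = (w ν).val % q := by rw [mul_comm]; omega
    rw [this]
    exact Nat.mod_lt _ hq0

/-- membership in the coarse cube by corner coordinates. [cite: Balaban1984PropagatorsI, (1.6) p.18, (1.18) p.20, bookkeeping] -/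
theorem mem_iterBlock_iff_corner {j : ℕ} (hj : j ≤ P.m + P.K) (y : Site P j) (w : Site P 0) :
    w ∈ iterBlock j y ↔ ∀ ν, (w ν - cubeCorner j y ν).val < P.L ^ j := by
  rw [mem_iterBlock_iff hj]
  exact ⟨fun h ν => (val_sub_corner_lt_iff hj y w ν).2 (h ν), fun h ν => (val_sub_corner_lt_iff hj y w ν).1 (h ν)⟩

/-- ★ **THE DOUBLE CUBE BY COORDINATES**: a fine site within `Lʲ` forward steps of the corner of `B^j(y)` in every direction except `μ`, and within `2Lʲ` in
direction `μ`, lies in `B^j(y)` or in `B^j(y + e_μ)`. [cite: Balaban1984PropagatorsI, (1.18) p.20 («x(b) is a point in B^k(b₊)»), bookkeeping] -/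
theorem iterBlockOf_of_double {j : ℕ} (hj : j ≤ P.m + P.K) (y : Site P j) (w : Site P 0) (μ : Fin P.d)
    (hν : ∀ ν, ν ≠ μ → (w ν - cubeCorner j y ν).val < P.L ^ j) (hμ : (w μ - cubeCorner j y μ).val < 2 * P.L ^ j) :
    iterBlockOf j w = y ∨ iterBlockOf j w = y.shift μ := by
  set q : ℕ := P.L ^ j with hq
  have hq0 : 0 < q := pow_pos P.L_pos _
  have hn : P.sitesPerDir 0 = q * P.sitesPerDir j := sitesPerDir_zero_eq_mul P hj
  by_cases hlt : (w μ - cubeCorner j y μ).val < q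
  · left
    rw [← mem_iterBlock, mem_iterBlock_iff_corner hj]
    intro ν
    by_cases h : ν = μ
    · rw [h]; exact hlt
    · exact hν ν h
  · right
    rw [← mem_iterBlock, mem_iterBlock_iff hj]
    intro ν
    by_cases h : ν = μ
    · subst h
      -- `label(w_ν) = (y_ν·Lʲ + r) mod |T^{(0)}|` with `Lʲ ≤ r < 2Lʲ`, so `⌊label∕Lʲ⌋ = (y_ν + 1) mod |T^{(j)}|`
      push Not at hlt
      set r : ℕ := (w ν - cubeCorner j y ν).val with hr
      have e : w ν = cubeCorner j y ν + (w ν - cubeCorner j y ν) := by abel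
      have hval : (w ν).val = ((y ν).val * q + r) % (q * P.sitesPerDir j) := by
        rw [← hn]
        conv_lhs => rw [e]
        rw [ZMod.val_add, val_cubeCorner hj y ν]
      have hrq : r / q = 1 := Nat.div_eq_of_lt_le (by omega) (by omega)
      have hsh : ((y.shift ν) ν).val = ((y ν).val + 1) % P.sitesPerDir j := by
        have e1 : (y.shift ν) ν = y ν + 1 := by
          show Function.update y ν (y ν + 1) ν = y ν + 1
          rw [Function.update_self]
        rw [e1, ZMod.val_add, ZMod.val_one_eq_one_mod, Nat.add_mod_mod]
      rw [hval, hsh, Nat.mod_mul_right_div_self, show (y ν).val * q + r = q * (y ν).val + r by ring, Nat.mul_add_div hq0, hrq]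
    · rw [← val_sub_corner_lt_iff hj]
      · have := hν ν h
        show (w ν - cubeCorner j (y.shift μ) ν).val < P.L ^ j
        have hs : (y.shift μ) ν = y ν := by
          show Function.update y μ (y μ + 1) ν = y ν
          rw [Function.update_of_ne h]
        unfold cubeCorner; rw [hs]; exact this

end Cube

/-! ## §2 The bond-averaging runs at a k-level index: every rung site lies in the double cube -/

section Runs

variable {d ℓ : ℕ} {hd : 1 ≤ d + 1} {hL : Odd (ℓ + 1) ∧ 1 < ℓ + 1} {b₀ b₁ : ℝ} (i : KIdx d ℓ hd hL b₀ b₁)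

/-- `4Lʲ ≦ |T^{(0)}|` for `j ≦ k` (the period is `L^{k+1}·M_h·P′₀`, `M_h ≧ 8`). [cite: Balaban1984PropagatorsII, (2.1) p.224, bookkeeping] -/
theorem four_mul_pow_le_period {j : ℕ} (hj : j ≤ i.k) : 4 * (ℓ + 1) ^ j ≤ (PV d ℓ i.m i.K hd hL).sitesPerDir 0 := by
  rw [← i.hN 0]
  show 4 * (ℓ + 1) ^ j ≤ (ℓ + 1) ^ i.k * ((ℓ + 1) * (i.Mh * i.P' 0))
  have h8 : 8 ≤ i.Mh := i.hM8
  have h5 : 5 ≤ i.P' 0 := i.hP5 0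
  have hpow : (ℓ + 1) ^ j ≤ (ℓ + 1) ^ i.k := Nat.pow_le_pow_right (by omega) hj
  have h40 : 4 ≤ (ℓ + 1) * (i.Mh * i.P' 0) :=
    calc 4 ≤ i.Mh * i.P' 0 := le_trans (by norm_num) (Nat.mul_le_mul h8 h5)
      _ ≤ (ℓ + 1) * (i.Mh * i.P' 0) := Nat.le_mul_of_pos_left _ (Nat.succ_pos ℓ)
  calc 4 * (ℓ + 1) ^ j = (ℓ + 1) ^ j * 4 := by ring
    _ ≤ (ℓ + 1) ^ i.k * ((ℓ + 1) * (i.Mh * i.P' 0)) := Nat.mul_le_mul hpow h40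

/-- the base point embeds INTO its cube: `iterBlockOf j (embIter j y) = y` (adapted from `B9CubeIndexBondsNearH.iterBlockOf_embIter'`; the series keeps
several private copies). [cite: Balaban1984PropagatorsI, (1.18) p.20, bookkeeping] -/
private theorem iterBlockOf_embIter₁ {P : Params} : ∀ (j : ℕ), j ≤ P.m + P.K → ∀ y : Site P j, iterBlockOf j (embIter j y) = y
  | 0, _, _ => rfl
  | j + 1, hj, y => by
      show blockOf (iterBlockOf j (embIter j (emb y))) = y
      rw [iterBlockOf_embIter₁ j (Nat.le_of_succ_le hj), Site.blockOf_emb hj]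

/-- the base point `embIter j ι₋` of an index bond lies in its source cube: every label within `Lʲ` forward steps of the corner's.
[cite: Balaban1984PropagatorsI, (1.18) p.20; Balaban1985BackgroundPropagators, (3.12) p.392, bookkeeping] -/
theorem val_embIter_sub_corner_lt (ι : IBondY i) (ν : Fin (d + 1)) :
    (embIter (ι.1.1 : ℕ) ι.1.2.src ν - cubeCorner (ι.1.1 : ℕ) ι.1.2.src ν).val < (ℓ + 1) ^ (ι.1.1 : ℕ) := by
  have hj : (ι.1.1 : ℕ) ≤ (PV d ℓ i.m i.K hd hL).m + (PV d ℓ i.m i.K hd hL).K := B6Ineq2142KLevelV1.lvl_le_mK i.hN i.D i.hk ι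
  have hmem : embIter (ι.1.1 : ℕ) ι.1.2.src ∈ iterBlock (ι.1.1 : ℕ) ι.1.2.src := by rw [mem_iterBlock]; exact iterBlockOf_embIter₁ _ hj _
  exact (mem_iterBlock_iff_corner hj _ _).1 hmem ν

/-- ★ **EVERY RUNG SITE OF A BOND-AVERAGING RUN LIES IN THE DOUBLE CUBE** `B^j(ι₋) ∪ B^j(ι₊)`: for an averaged fine bond `f` (`qK ι f ≠ 0`, so
`f = [x + te_μ, x + (t+1)e_μ]`, `x ∈ B^j(ι₋)`, `t < Lʲ`), the taxicab contour from the base point `embIter j ι₋` to `f₋` runs, coordinatewise on the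
shorter arcs, inside `[corner, corner + Lʲ)` (directions `≠ μ`) and `[corner, corner + 2Lʲ)` (direction `μ`).
[cite: Balaban1985BackgroundPropagators, (3.12) p.392, (3.40) p.397; Balaban1984PropagatorsI, (1.18) p.20] -/
theorem rung_mem_double_of_qK_ne_zero {ι : IBondY i} {f : FBondY i} (h : qK i ι f ≠ 0)
    (r : Site (PV d ℓ i.m i.K hd hL) 0 × Fin (d + 1) × Bool)
    (hr : r ∈ rungSites (taxiSteps (List.finRange (d + 1)) (embIter (ι.1.1 : ℕ) ι.1.2.src) f.src) (embIter (ι.1.1 : ℕ) ι.1.2.src)) :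
    iterBlockOf (ι.1.1 : ℕ) r.1 = ι.1.2.src ∨ iterBlockOf (ι.1.1 : ℕ) r.1 = ι.1.2.tgt := by
  have hj : (ι.1.1 : ℕ) ≤ (PV d ℓ i.m i.K hd hL).m + (PV d ℓ i.m i.K hd hL).K := B6Ineq2142KLevelV1.lvl_le_mK i.hN i.D i.hk ι
  have hjk : (ι.1.1 : ℕ) ≤ i.k := B6Ineq2142KLevelV1.lvl_le i.hN i.D i.hk ι
  set q : ℕ := (ℓ + 1) ^ (ι.1.1 : ℕ) with hq
  have hq0 : 0 < q := by positivity
  have h4 := four_mul_pow_le_period i hjk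
  rw [qK_apply] at h
  obtain ⟨x, hx, t, ht, hf⟩ := exists_of_qwt_ne_zero i.hN i.D i.hk ι h
  have ht' : t < q := ht
  set c := embIter (ι.1.1 : ℕ) ι.1.2.src with hcdef
  have hz : f.src = runSite x ι.1.2.dir t := by rw [← hf]; rfl
  -- the corner coordinates of the start, the end, hence of every rung site
  have hc : ∀ ν, (c ν - cubeCorner (ι.1.1 : ℕ) ι.1.2.src ν).val < q := val_embIter_sub_corner_lt i ι
  have hx' : ∀ ν, (x ν - cubeCorner (ι.1.1 : ℕ) ι.1.2.src ν).val < q := (mem_iterBlock_iff_corner hj _ _).1 hx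
  have hzν : ∀ ν, ν ≠ ι.1.2.dir → (f.src ν - cubeCorner (ι.1.1 : ℕ) ι.1.2.src ν).val < q := fun ν hν => by
    rw [hz, runSite, Function.update_of_ne hν]; exact hx' ν
  have hzμ : (f.src ι.1.2.dir - cubeCorner (ι.1.1 : ℕ) ι.1.2.src ι.1.2.dir).val < 2 * q := by
    rw [hz, runSite, Function.update_self, show x ι.1.2.dir + (t : ZMod _) - cubeCorner (ι.1.1 : ℕ) ι.1.2.src ι.1.2.dir =
      (x ι.1.2.dir - cubeCorner (ι.1.1 : ℕ) ι.1.2.src ι.1.2.dir) + (t : ZMod _) by abel]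
    refine lt_of_le_of_lt (ZMod.val_add_le _ _) ?_
    have h1 := hx' ι.1.2.dir
    have h2 : ((t : ZMod ((PV d ℓ i.m i.K hd hL).sitesPerDir 0))).val ≤ t := by rw [ZMod.val_natCast]; exact Nat.mod_le _ _
    omega
  obtain ⟨-, -, hon⟩ := rungSites_taxiSteps f.src (List.finRange (d + 1)) (List.nodup_finRange _) c r hr
  have hrν : ∀ ν, ν ≠ ι.1.2.dir → (r.1 ν - cubeCorner (ι.1.1 : ℕ) ι.1.2.src ν).val < q := fun ν hν =>
    onArc_mem_interval (by omega) (hc ν) (hzν ν hν) (hon ν (List.mem_finRange ν)).1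
  have hrμ : (r.1 ι.1.2.dir - cubeCorner (ι.1.1 : ℕ) ι.1.2.src ι.1.2.dir).val < 2 * q :=
    onArc_mem_interval (by omega) ((hc _).trans (by omega)) hzμ (hon _ (List.mem_finRange _)).1
  exact iterBlockOf_of_double hj ι.1.2.src r.1 ι.1.2.dir hrν hrμ

/-- hence every rung site has level `≥ j − 1` ([4] (2.2): the fine sites of the double block of an index bond of level `j`).
[cite: Balaban1984PropagatorsII, (2.2)–(2.4) p.224; Balaban1985BackgroundPropagators, (3.12) p.392] -/
theorem pred_lvl_le_levV1_rung {ι : IBondY i} {f : FBondY i} (h : qK i ι f ≠ 0)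
    (r : Site (PV d ℓ i.m i.K hd hL) 0 × Fin (d + 1) × Bool)
    (hr : r ∈ rungSites (taxiSteps (List.finRange (d + 1)) (embIter (ι.1.1 : ℕ) ι.1.2.src) f.src) (embIter (ι.1.1 : ℕ) ι.1.2.src)) :
    (ι.1.1 : ℕ) - 1 ≤ levV1 i r.1 :=
  (lev_ends_bounds i.hN i.D i.hk (le_trans one_le_two i.hk2) (two_le_RMh i) ι (rung_mem_double_of_qK_ne_zero i h r hr)).1

/-- the run has at most `(d+1)(2Lʲ − 1)` steps. [cite: Balaban1985BackgroundPropagators, (3.40) p.397, (3.12) p.392, bookkeeping] -/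
theorem length_qRun_le {ι : IBondY i} {f : FBondY i} (h : qK i ι f ≠ 0) :
    (taxiSteps (List.finRange (d + 1)) (embIter (ι.1.1 : ℕ) ι.1.2.src) f.src).length ≤ (d + 1) * (2 * (ℓ + 1) ^ (ι.1.1 : ℕ) - 1) := by
  have hj : (ι.1.1 : ℕ) ≤ (PV d ℓ i.m i.K hd hL).m + (PV d ℓ i.m i.K hd hL).K := B6Ineq2142KLevelV1.lvl_le_mK i.hN i.D i.hk ι
  set q : ℕ := (ℓ + 1) ^ (ι.1.1 : ℕ) with hq
  rw [qK_apply] at h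
  obtain ⟨x, hx, t, ht, hf⟩ := exists_of_qwt_ne_zero i.hN i.D i.hk ι h
  have ht' : t < q := ht
  have hz : f.src = runSite x ι.1.2.dir t := by rw [← hf]; rfl
  have hc : ∀ ν, (embIter (ι.1.1 : ℕ) ι.1.2.src ν - cubeCorner (ι.1.1 : ℕ) ι.1.2.src ν).val < 2 * q :=
    fun ν => (val_embIter_sub_corner_lt i ι ν).trans_le (by omega)
  have hx' : ∀ ν, (x ν - cubeCorner (ι.1.1 : ℕ) ι.1.2.src ν).val < q := (mem_iterBlock_iff_corner hj _ _).1 hx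
  have hzall : ∀ ν, (f.src ν - cubeCorner (ι.1.1 : ℕ) ι.1.2.src ν).val < 2 * q := by
    intro ν
    by_cases hν : ν = ι.1.2.dir
    · subst hν
      rw [hz, runSite, Function.update_self, show x ι.1.2.dir + (t : ZMod _) - cubeCorner (ι.1.1 : ℕ) ι.1.2.src ι.1.2.dir =
        (x ι.1.2.dir - cubeCorner (ι.1.1 : ℕ) ι.1.2.src ι.1.2.dir) + (t : ZMod _) by abel]
      refine lt_of_le_of_lt (ZMod.val_add_le _ _) ?_
      have h1 := hx' ι.1.2.dir
      have h2 : ((t : ZMod ((PV d ℓ i.m i.K hd hL).sitesPerDir 0))).val ≤ t := by rw [ZMod.val_natCast]; exact Nat.mod_le _ _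
      omega
    · rw [hz, runSite, Function.update_of_ne hν]; exact (hx' ν).trans_le (by omega)
  have hK : ∀ ν, min (f.src ν - embIter (ι.1.1 : ℕ) ι.1.2.src ν).val (embIter (ι.1.1 : ℕ) ι.1.2.src ν - f.src ν).val ≤ 2 * q - 1 :=
    fun ν => min_val_sub_le (hc ν) (hzall ν)
  have hlen := length_taxiSteps_le (embIter (ι.1.1 : ℕ) ι.1.2.src) f.src hK (List.finRange (d + 1))
  rwa [List.length_finRange] at hlen

end Runs

/-! ## §3 ★★ The product defect along a bond-averaging run -/

section Estimate

variable {d ℓ : ℕ} {hd : 1 ≤ d + 1} {hL : Odd (ℓ + 1) ∧ 1 < ℓ + 1} {b₀ b₁ : ℝ} [NormOneClass 𝔸] (i : KIdx d ℓ hd hL b₀ b₁) (G : Subgroup 𝔸ˣ)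

/-- the arithmetic «(1+ε)ⁿ − 1 ≦ nε·e^{nε}», «(1+ε)ⁿ ≦ e^{nε}» of «α₁ sufficiently small» (g8's private `pow_sub_one_le`, restated for this run).
[cite: Balaban1985BackgroundPropagators, p.401 («for α₁ sufficiently small»), bookkeeping] -/
theorem pow_le_exp_and_sub_one_le {ε : ℝ} (hε : 0 ≤ ε) (n : ℕ) :
    (1 + ε) ^ n ≤ Real.exp (n * ε) ∧ (1 + ε) ^ n - 1 ≤ n * ε * Real.exp (n * ε) := by
  have h1 : (1 + ε) ^ n ≤ Real.exp (n * ε) := by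
    calc (1 + ε) ^ n ≤ (Real.exp ε) ^ n := pow_le_pow_left₀ (by linarith) (by linarith [Real.add_one_le_exp ε]) n
      _ = Real.exp (n * ε) := by rw [← Real.exp_nat_mul]
  have h2 : Real.exp (n * ε) - 1 ≤ n * ε * Real.exp (n * ε) := by
    have h := Real.add_one_le_exp (-(n * ε))
    have hpos := Real.exp_pos (n * ε)
    have h3 : (-(n * ε) + 1) * Real.exp (n * ε) ≤ Real.exp (-(n * ε)) * Real.exp (n * ε) := mul_le_mul_of_nonneg_right h hpos.le
    rw [← Real.exp_add, neg_add_cancel, Real.exp_zero] at h3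
    nlinarith
  exact ⟨h1, by linarith⟩

/-- ★★ **THE KEY ESTIMATE OF p. 401 ALONG A BOND-AVERAGING RUN**: for a `G`-valued (unit-norm) `U`, a field `a` in r06's class (3.37) on the member's torus
chart at exponent `0 ≦ α₁ ≦ 1∕4`, and an averaged fine bond `f` of the index bond `ι` (`qK ι f ≠ 0`), along the taxicab contour `Γ` from the base point
`embIter j ι₋` to `f₋`: `‖(e^{iηa}U)(Γ) − U(Γ)‖ ≦ 4(d+1)L·e^{(d+1)L}·α₁`, `‖((e^{iηa}U)(Γ))⁻¹ − (U(Γ))⁻¹‖ ≦ e^{(d+1)L}·4(d+1)L·e^{(d+1)L}·α₁`, and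
`‖(e^{iηa}U)(Γ)‖, ‖((e^{iηa}U)(Γ))⁻¹‖ ≦ e^{(d+1)L}` (every rung has level `≥ j − 1`, where (3.37) gives `η|a| ≦ α₁L^{−(j−1)}`; at most `(d+1)(2Lʲ − 1)`
steps). [cite: Balaban1985BackgroundPropagators, p.401 («|(U′U)(Γ)(U(Γ))⁻¹ − 1| < O(1)α₁»), (3.37) p.396, (3.12) p.392; Balaban1984PropagatorsII, (2.2) p.224] -/
theorem norm_parTaxiV_qRun_sub_le (hG1 : ∀ u : 𝔸ˣ, u ∈ G → ‖(u : 𝔸)‖ ≤ 1) {U : CfgY 𝔸 i} (hU : GVal G i U) (a : AfldY 𝔸 i)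
    {α₁ : ℝ} (hα₁ : 0 ≤ α₁) (hα₁4 : α₁ ≤ 1 / 4)
    (h37 : Cplx337 (shiftsV1 (PV d ℓ i.m i.K hd hL)) U (kGeo i).eta (kGeo i).L (levV1 i) α₁ a)
    {ι : IBondY i} {f : FBondY i} (hq : qK i ι f ≠ 0) :
    ‖((parTaxiV (mulY i (fluct (kGeo i).eta a) U) (embIter (ι.1.1 : ℕ) ι.1.2.src) f.src : 𝔸ˣ) : 𝔸) -
        (parTaxiV U (embIter (ι.1.1 : ℕ) ι.1.2.src) f.src : 𝔸)‖ ≤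
        4 * ((d : ℝ) + 1) * ((ℓ : ℝ) + 1) * Real.exp (((d : ℝ) + 1) * ((ℓ : ℝ) + 1)) * α₁ ∧
      ‖(((parTaxiV (mulY i (fluct (kGeo i).eta a) U) (embIter (ι.1.1 : ℕ) ι.1.2.src) f.src)⁻¹ : 𝔸ˣ) : 𝔸) -
        (((parTaxiV U (embIter (ι.1.1 : ℕ) ι.1.2.src) f.src)⁻¹ : 𝔸ˣ) : 𝔸)‖ ≤
        Real.exp (((d : ℝ) + 1) * ((ℓ : ℝ) + 1)) * (4 * ((d : ℝ) + 1) * ((ℓ : ℝ) + 1) * Real.exp (((d : ℝ) + 1) * ((ℓ : ℝ) + 1)) * α₁) ∧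
      ‖((parTaxiV (mulY i (fluct (kGeo i).eta a) U) (embIter (ι.1.1 : ℕ) ι.1.2.src) f.src : 𝔸ˣ) : 𝔸)‖ ≤ Real.exp (((d : ℝ) + 1) * ((ℓ : ℝ) + 1)) ∧
      ‖(((parTaxiV (mulY i (fluct (kGeo i).eta a) U) (embIter (ι.1.1 : ℕ) ι.1.2.src) f.src)⁻¹ : 𝔸ˣ) : 𝔸)‖ ≤ Real.exp (((d : ℝ) + 1) * ((ℓ : ℝ) + 1)) := by
  set η : ℝ := (kGeo i).eta with hη
  set j : ℕ := (ι.1.1 : ℕ) with hjdef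
  set c := embIter (ι.1.1 : ℕ) ι.1.2.src with hcdef
  set l := taxiSteps (List.finRange (d + 1)) c f.src with hl
  set Lr : ℝ := (ℓ : ℝ) + 1 with hLr
  set CL : ℝ := Real.exp (((d : ℝ) + 1) * Lr) with hCL
  have hη0 : 0 < η := geo9K_eta_pos i
  have hL1 : (1 : ℝ) ≤ Lr := by rw [hLr]; have : (0 : ℝ) ≤ ℓ := Nat.cast_nonneg _; linarith
  have hLeq : (kGeo i).L = Lr := by rw [hLr]; show (((ℓ + 1 : ℕ) : ℝ)) = _; push_cast; ring
  have hj1 : 1 ≤ j := one_le_lvl i.hN i.D i.hk (le_trans one_le_two i.hk2) ι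
  have hUu : ∀ μ x, UnitaryLike (U μ x) := fun μ x => norm_le_one_and_inv_of_mem G hG1 (hU μ x)
  -- the transporters as signed step runs over the same steps
  have hW : parTaxiV (mulY i (fluct η a) U) c f.src = stepRun (fun μ x => fluct η a μ x * U μ x) l c := parTaxiV_eq_stepRun _ c f.src
  have hUr : parTaxiV U c f.src = stepRun U l c := parTaxiV_eq_stepRun U c f.src
  -- the per-bond size of the multiplier on the rungs: level `≥ j − 1` there, own-level (3.37)
  set x₀ : ℝ := α₁ * ((Lr ^ (j - 1)))⁻¹ with hx₀
  have hLp : (1 : ℝ) ≤ Lr ^ (j - 1) := one_le_pow₀ hL1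
  have hx₀0 : 0 ≤ x₀ := by positivity
  have hx₀α : x₀ ≤ α₁ := by
    rw [hx₀]; exact mul_le_of_le_one_right hα₁ (inv_le_one_of_one_le₀ hLp)
  have hx₀4 : x₀ ≤ 1 / 4 := hx₀α.trans hα₁4
  set ε : ℝ := 2 * x₀ with hε
  have hε0 : 0 ≤ ε := by positivity
  obtain ⟨hA, -⟩ := h37
  have hrung : ∀ r ∈ rungSites l c, ‖((fluct η a r.2.1 r.1 : 𝔸ˣ) : 𝔸) - 1‖ ≤ ε ∧ ‖(((fluct η a r.2.1 r.1)⁻¹ : 𝔸ˣ) : 𝔸) - 1‖ ≤ ε := by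
    intro r hr
    have hlev : OnOmega (levV1 i) (j - 1) r.1 := pred_lvl_le_levV1_rung i hq r hr
    have hb := hA (j - 1) r.2.1 r.1 hlev
    have hsl : scaleLen (kGeo i).L η (j - 1) = Lr ^ (j - 1) * η := by rw [scaleLen, hLeq]
    rw [hsl, mul_inv] at hb
    have hx : η * ‖a r.2.1 r.1‖ ≤ x₀ := by
      rw [hx₀]
      calc η * ‖a r.2.1 r.1‖ ≤ η * (α₁ * ((Lr ^ (j - 1))⁻¹ * η⁻¹)) := mul_le_mul_of_nonneg_left hb.le hη0.le
        _ = α₁ * (Lr ^ (j - 1))⁻¹ := by field_simp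
    exact norm_fluct_sub_one_le i hη0.le a r.2.1 r.1 hx hx₀4
  have hrungb : ∀ r ∈ rungSites l c, ‖((fluct η a r.2.1 r.1 : 𝔸ˣ) : 𝔸)‖ ≤ 1 + ε ∧ ‖(((fluct η a r.2.1 r.1)⁻¹ : 𝔸ˣ) : 𝔸)‖ ≤ 1 + ε := by
    intro r hr
    obtain ⟨e1, e2⟩ := hrung r hr
    exact ⟨by simpa using (norm_le_norm_add_norm_sub' ((fluct η a r.2.1 r.1 : 𝔸ˣ) : 𝔸) 1).trans (by rw [norm_one]; linarith),
      by simpa using (norm_le_norm_add_norm_sub' (((fluct η a r.2.1 r.1)⁻¹ : 𝔸ˣ) : 𝔸) 1).trans (by rw [norm_one]; linarith)⟩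
  -- the number of steps and the arithmetic `nε ≤ 4(d+1)Lα₁`
  have hlen : l.length ≤ (d + 1) * (2 * (ℓ + 1) ^ j - 1) := length_qRun_le i hq
  have hnε : (l.length : ℝ) * ε ≤ 4 * ((d : ℝ) + 1) * Lr * α₁ := by
    have hq1 : (((2 * (ℓ + 1) ^ j - 1 : ℕ)) : ℝ) ≤ 2 * Lr * Lr ^ (j - 1) := by
      have hq0 : 1 ≤ 2 * (ℓ + 1) ^ j := le_trans (Nat.one_le_pow _ _ (Nat.succ_pos ℓ)) (Nat.le_mul_of_pos_left _ two_pos)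
      rw [Nat.cast_sub hq0]
      have e : ((ℓ : ℝ) + 1) ^ j = Lr * Lr ^ (j - 1) := by
        rw [hLr, ← pow_succ']; congr 1; omega
      push_cast
      rw [e]; linarith [show (0:ℝ) ≤ Lr * Lr ^ (j - 1) by positivity]
    have h1 : (l.length : ℝ) ≤ ((d : ℝ) + 1) * (2 * Lr * Lr ^ (j - 1)) := by
      have : (l.length : ℝ) ≤ (((d + 1) * (2 * (ℓ + 1) ^ j - 1) : ℕ) : ℝ) := by exact_mod_cast hlen
      refine this.trans ?_
      rw [Nat.cast_mul]; push_cast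
      exact mul_le_mul_of_nonneg_left hq1 (by positivity)
    have hpos : 0 < Lr ^ (j - 1) := by positivity
    calc (l.length : ℝ) * ε ≤ ((d : ℝ) + 1) * (2 * Lr * Lr ^ (j - 1)) * ε := mul_le_mul_of_nonneg_right h1 hε0
      _ = 4 * ((d : ℝ) + 1) * Lr * α₁ * (Lr ^ (j - 1) * (Lr ^ (j - 1))⁻¹) := by rw [hε, hx₀]; ring
      _ = 4 * ((d : ℝ) + 1) * Lr * α₁ := by rw [mul_inv_cancel₀ hpos.ne', mul_one]
  have hnε1 : (l.length : ℝ) * ε ≤ ((d : ℝ) + 1) * Lr := by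
    have : 4 * ((d : ℝ) + 1) * Lr * α₁ ≤ ((d : ℝ) + 1) * Lr := by
      have h0 : 0 ≤ ((d : ℝ) + 1) * Lr := by positivity
      nlinarith
    exact hnε.trans this
  obtain ⟨hP0, hP1⟩ := pow_le_exp_and_sub_one_le hε0 l.length
  have hE : Real.exp ((l.length : ℝ) * ε) ≤ CL := Real.exp_le_exp.2 hnε1
  have hP0' : (1 + ε) ^ l.length ≤ CL := hP0.trans hE
  have hP1' : (1 + ε) ^ l.length - 1 ≤ 4 * ((d : ℝ) + 1) * Lr * CL * α₁ := by
    refine hP1.trans ?_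
    have hCL0 : 0 ≤ Real.exp ((l.length : ℝ) * ε) := (Real.exp_pos _).le
    calc (l.length : ℝ) * ε * Real.exp ((l.length : ℝ) * ε) ≤ (4 * ((d : ℝ) + 1) * Lr * α₁) * CL :=
          mul_le_mul hnε hE hCL0 (by positivity)
      _ = 4 * ((d : ℝ) + 1) * Lr * CL * α₁ := by ring
  have hA' := norm_stepRun_prod_sub_le hUu hε0 l c hrung
  have hB := norm_inv_stepRun_prod_sub_le hUu hε0 l c hrung
  have hC := norm_stepRun_prod_le hUu hε0 l c hrungb
  have hD := norm_inv_stepRun_prod_le hUu hε0 l c hrungb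
  have h0 : 0 ≤ (1 + ε) ^ l.length - 1 := by
    have := one_le_pow₀ (show (1 : ℝ) ≤ 1 + ε by linarith) (n := l.length); linarith
  rw [hW, hUr]
  refine ⟨hA'.trans hP1', hB.trans (mul_le_mul hP0' hP1' h0 (Real.exp_nonneg _)), hC.trans hP0', hD.trans hP0'⟩

end Estimate

/-! ## §4 ★★★ The transporter-variation law at NODE 00's taxicab transporters -/

section Law

variable {d ℓ : ℕ} {hd : 1 ≤ d + 1} {hL : Odd (ℓ + 1) ∧ 1 < ℓ + 1} {b₀ b₁ : ℝ} [NormOneClass 𝔸] {Mstar : ℕ} (G : Subgroup 𝔸ˣ)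
  (x : MemberY d ℓ hd hL b₀ b₁ Mstar)

/-- **THE CONSTANT `c_var = 8(d+1)L·e^{3(d+1)L}` OF THE LAW** (print's `O(1)` of (3.81) for the taxicab transporters).
[cite: Balaban1985BackgroundPropagators, (3.81) p.406 («O(1)α₁»), bookkeeping] -/
def cVarGY (d ℓ : ℕ) : ℝ := 8 * ((d : ℝ) + 1) * ((ℓ : ℝ) + 1) * Real.exp (3 * (((d : ℝ) + 1) * ((ℓ : ℝ) + 1)))

/-- `0 ≦ c_var`. [cite: Balaban1985BackgroundPropagators, (3.81) p.406, bookkeeping] -/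
theorem cVarGY_nonneg (d ℓ : ℕ) : 0 ≤ cVarGY d ℓ := by unfold cVarGY; positivity

omit [NormOneClass 𝔸] in
/-- the law is monotone in its exponent. [cite: Balaban1985BackgroundPropagators, (3.81) p.406, bookkeeping] -/
theorem varParBY_mono (i : KIdx d ℓ hd hL b₀ b₁) (parB : Node00.BondParY 𝔸 i) {cVar β β' : ℝ} (hc : 0 ≤ cVar) (hβ : β ≤ β')
    {U : CfgY 𝔸 i} {a : AfldY 𝔸 i} (h : VarParBY i parB cVar β U a) : VarParBY i parB cVar β' U a := by
  intro ι f hq E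
  obtain ⟨h1, h2⟩ := h ι f hq E
  have hm : cVar * β * ‖E‖ ≤ cVar * β' * ‖E‖ := mul_le_mul_of_nonneg_right (mul_le_mul_of_nonneg_left hβ hc) (norm_nonneg E)
  exact ⟨h1.trans hm, h2.trans hm⟩

/-- ★★★ **THE TRANSPORTER-VARIATION LAW `VarParBY` AT NODE 00's TAXICAB TRANSPORTERS `parBY`, FROM (3.37)**: for `U` `G`-valued (unit-norm `G`) and `a` in r06's
class `Cplx337` on the member's torus chart at exponent `0 ≦ α₁ ≦ 1∕4`, along every bond-averaging contour (index bond `ι`, averaged fine bond `f`) the adjoint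
actions of the transporters of `e^{iηa}·U` and of `U`, and of their inverses, differ by `≦ c_var·α₁` in operator norm, `c_var = 8(d+1)L·e^{3(d+1)L}` — the
displayed law `hvarB` of gen 13's `gFrame₅CodedOn` at the record (`‖R(p′) − R(p)‖ ≦ ‖p′ − p‖‖p′⁻¹‖ + ‖p‖‖p′⁻¹ − p⁻¹‖` with §3).
[cite: Balaban1985BackgroundPropagators, (3.80)–(3.81) p.406, p.401, (3.37) p.396, (3.12) p.392] -/
theorem varParBY_parBY_of_cplx337 (hG1 : ∀ u : 𝔸ˣ, u ∈ G → ‖(u : 𝔸)‖ ≤ 1) {U : CfgY 𝔸 x.toKIdx} (hU : GVal G x.toKIdx U)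
    {α₁ : ℝ} (hα₁ : 0 ≤ α₁) (hα₁4 : α₁ ≤ 1 / 4) {a : AfldY 𝔸 x.toKIdx}
    (h37 : Cplx337 (shiftsV1 (PV d ℓ x.m x.K hd hL)) U (kGeo x.toKIdx).eta (kGeo x.toKIdx).L (levV1 x.toKIdx) α₁ a) :
    VarParBY x.toKIdx (parBY x.toKIdx) (cVarGY d ℓ) α₁ U a := by
  intro ι f hq E
  show _ ≤ 8 * ((d : ℝ) + 1) * ((ℓ : ℝ) + 1) * Real.exp (3 * (((d : ℝ) + 1) * ((ℓ : ℝ) + 1))) * α₁ * ‖E‖ ∧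
    _ ≤ 8 * ((d : ℝ) + 1) * ((ℓ : ℝ) + 1) * Real.exp (3 * (((d : ℝ) + 1) * ((ℓ : ℝ) + 1))) * α₁ * ‖E‖
  set CL : ℝ := Real.exp (((d : ℝ) + 1) * ((ℓ : ℝ) + 1)) with hCL
  set B : ℝ := 4 * ((d : ℝ) + 1) * ((ℓ : ℝ) + 1) * CL * α₁ with hB
  have hCL1 : 1 ≤ CL := Real.one_le_exp (by positivity)
  have hCL0 : 0 ≤ CL := zero_le_one.trans hCL1
  have hB0 : 0 ≤ B := by positivity
  have hE3 : Real.exp (3 * (((d : ℝ) + 1) * ((ℓ : ℝ) + 1))) = CL * CL * CL := by rw [hCL, ← Real.exp_add, ← Real.exp_add]; ring_nf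
  have hUu : ∀ μ v, UnitaryLike (U μ v) := fun μ v => norm_le_one_and_inv_of_mem G hG1 (hU μ v)
  obtain ⟨hA', hB', hC', hD'⟩ := norm_parTaxiV_qRun_sub_le x.toKIdx G hG1 hU a hα₁ hα₁4 h37 hq
  set q' : 𝔸ˣ := parTaxiV (mulY x.toKIdx (fluct (kGeo x.toKIdx).eta a) U) (embIter (ι.1.1 : ℕ) ι.1.2.src) f.src with hq'
  set q : 𝔸ˣ := parTaxiV U (embIter (ι.1.1 : ℕ) ι.1.2.src) f.src with hqdef
  have hqu : UnitaryLike q := by rw [hqdef, parTaxiV_eq_stepRun]; exact unitaryLike_stepRun hUu _ _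
  -- the two transporters of the law ARE `q′`, `q`
  have e1 : qT x.toKIdx (parBY x.toKIdx) (decY x.toKIdx (.prod U a)) ι f = q' := rfl
  have e2 : qT x.toKIdx (parBY x.toKIdx) U ι f = q := rfl
  rw [e1, e2]
  have key : ∀ (p' p : 𝔸ˣ) (X : 𝔸), ‖R p' X - R p X‖ ≤ (‖(p' : 𝔸) - (p : 𝔸)‖ * ‖((p'⁻¹ : 𝔸ˣ) : 𝔸)‖ + ‖(p : 𝔸)‖ * ‖((p'⁻¹ : 𝔸ˣ) : 𝔸) - ((p⁻¹ : 𝔸ˣ) : 𝔸)‖) * ‖X‖ := by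
    intro p' p X
    have e : R p' X - R p X = (Rclm p' - Rclm p) X := by simp [Rclm_apply]
    rw [e]
    exact (ContinuousLinearMap.le_opNorm _ _).trans (mul_le_mul_of_nonneg_right (norm_Rclm_sub_le p' p) (norm_nonneg _))
  have hfin : 2 * B * (CL * CL) ≤ 8 * ((d : ℝ) + 1) * ((ℓ : ℝ) + 1) * Real.exp (3 * (((d : ℝ) + 1) * ((ℓ : ℝ) + 1))) * α₁ := by
    rw [hE3, hB]; nlinarith [hCL1, hCL0, hα₁, mul_nonneg (mul_nonneg hCL0 hCL0) hα₁,
      show 0 ≤ ((d : ℝ) + 1) * ((ℓ : ℝ) + 1) by positivity]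
  constructor
  · refine (key q' q E).trans (mul_le_mul_of_nonneg_right ?_ (norm_nonneg E))
    calc ‖(q' : 𝔸) - (q : 𝔸)‖ * ‖((q'⁻¹ : 𝔸ˣ) : 𝔸)‖ + ‖(q : 𝔸)‖ * ‖((q'⁻¹ : 𝔸ˣ) : 𝔸) - ((q⁻¹ : 𝔸ˣ) : 𝔸)‖
        ≤ B * CL + 1 * (CL * B) := by gcongr; exact hqu.1
      _ ≤ 2 * B * (CL * CL) := by nlinarith [hCL1, hB0, mul_nonneg hB0 hCL0]
      _ ≤ _ := hfin
  · refine (key q'⁻¹ q⁻¹ E).trans (mul_le_mul_of_nonneg_right ?_ (norm_nonneg E))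
    rw [inv_inv, inv_inv]
    calc ‖((q'⁻¹ : 𝔸ˣ) : 𝔸) - ((q⁻¹ : 𝔸ˣ) : 𝔸)‖ * ‖(q' : 𝔸)‖ + ‖((q⁻¹ : 𝔸ˣ) : 𝔸)‖ * ‖(q' : 𝔸) - (q : 𝔸)‖
        ≤ (CL * B) * CL + 1 * B := by gcongr; exact hqu.2
      _ ≤ 2 * B * (CL * CL) := by nlinarith [hCL1, hB0, mul_nonneg hB0 hCL0, mul_nonneg (mul_nonneg hB0 hCL0) hCL0]
      _ ≤ _ := hfin

end Law

end Literature.MathematicalPhysics.QuantumFieldTheory.Balaban1983to89.B9Eq359VarParBY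

end
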